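import Mathlib

/-! # Route CapacityClassicality — Liouville lower bound at an embedding (stub for crux stmt-Langlands-8927, line Sketch)

A non-zero algebraic integer `c` of a number field `E` that is divisible by `p ^ m` in `𝓞 E`
has a complex conjugate of absolute value at least `p ^ m`: writing `c = p ^ m * d` with
`d ≠ 0`, the (infinite part of the) product formula `∏_w w(d) ^ mult w = |N_{E/ℚ}(d)|` and
`|N_{E/ℚ}(d)| ≥ 1` (a non-zero rational integer) give an infinite place `w` with `1 ≤ w d`,
and at the embedding `σ = w.embedding` one gets `‖σ c‖ = p ^ m * w d ≥ p ^ m`.  This is the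
archimedean ("Liouville") half of the ghost-tower squeeze of the residual stub
`TowerRigidity`.
-/

set_option linter.dupNamespace false -- `Summit.Langlands.Langlands` is the mandated namespace

open NumberField

namespace Summit.Langlands.Langlands.Theorems.CapacityClassicality

/-- A non-zero algebraic integer `d` of a number field `E` has absolute value at least `1` at
some infinite place: otherwise every factor of `∏_w w(d) ^ mult w = |N_{E/ℚ}(d)|` would be
`< 1`, contradicting `1 ≤ |N_{E/ℚ}(d)|` (Mathlib's `InfinitePlace.one_le_of_lt_one` applied at
an arbitrary place). [folklore] -/
theorem exists_infinitePlace_one_le_of_ne_zero (E : Type) [Field E] [NumberField E]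
    (d : 𝓞 E) (hd : d ≠ 0) : ∃ w : InfinitePlace E, 1 ≤ w (d : E) := by
  by_contra h
  push Not at h
  obtain ⟨w⟩ := (inferInstance : Nonempty (InfinitePlace E))
  exact absurd (InfinitePlace.one_le_of_lt_one (w := w) hd fun z _ => h z) (not_le.mpr (h w))

/-- **Liouville lower bound at an embedding.** If `c ≠ 0` in the ring of integers `𝓞 E` of a
number field `E` and `p ^ m ∣ c`, then some complex embedding `σ : E →+* ℂ` satisfies
`p ^ m ≤ ‖σ c‖`.  Proof: `c = p ^ m * d` with `d ≠ 0`; pick an infinite place `w` with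
`1 ≤ w d` (product formula, `exists_infinitePlace_one_le_of_ne_zero`) and take
`σ = w.embedding`, so that `‖σ c‖ = p ^ m * w d ≥ p ^ m`. [folklore] -/
theorem exists_embedding_norm_ge_of_prime_pow_dvd (E : Type) [Field E] [NumberField E]
    (p : ℕ) (hp : p.Prime) (m : ℕ) (c : 𝓞 E) (hc : c ≠ 0) (hdvd : ((p : 𝓞 E) ^ m) ∣ c) :
    ∃ σ : E →+* ℂ, (p : ℝ) ^ m ≤ ‖σ (c : E)‖ := by
  obtain ⟨d, rfl⟩ := hdvd
  have hd : d ≠ 0 := by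
    rintro rfl
    exact hc (mul_zero _)
  obtain ⟨w, hw⟩ := exists_infinitePlace_one_le_of_ne_zero E d hd
  refine ⟨w.embedding, ?_⟩
  rw [InfinitePlace.norm_embedding_eq, RingOfIntegers.coe_eq_algebraMap, map_mul, map_pow,
    map_natCast, map_mul, map_pow, InfinitePlace.map_natCast]
  calc (p : ℝ) ^ m = (p : ℝ) ^ m * 1 := (mul_one _).symm
    _ ≤ (p : ℝ) ^ m * w (algebraMap (𝓞 E) E d) :=
      mul_le_mul_of_nonneg_left hw (pow_pos (Nat.cast_pos.mpr hp.pos) m).le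

/-- **Liouville lower bound at an embedding**, under the name registered for the stub of line
`Sketch` (crux `stmt-Langlands-8927`): verbatim restatement of
`exists_embedding_norm_ge_of_prime_pow_dvd`. [folklore] -/
theorem stub_exists_embedding_norm_ge_of_prime_pow_dvd (E : Type) [Field E] [NumberField E]
    (p : ℕ) (hp : p.Prime) (m : ℕ) (c : 𝓞 E) (hc : c ≠ 0) (hdvd : ((p : 𝓞 E) ^ m) ∣ c) :
    ∃ σ : E →+* ℂ, (p : ℝ) ^ m ≤ ‖σ (c : E)‖ :=
  exists_embedding_norm_ge_of_prime_pow_dvd E p hp m c hc hdvd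

end Summit.Langlands.Langlands.Theorems.CapacityClassicality
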